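import Mathlib
import Summits.MatrixMultiplication.Statement
import Summits.MatrixMultiplication.MatrixMultiplication.Theorems.GraphEquationsKernel
import Summits.MatrixMultiplication.MatrixMultiplication.Theorems.GraphEquationsOrderObstruction

/-!
# The ORDER OBSTRUCTION II: squared systems — in-ideal isolation order is unbounded along every admissible exponent (`GraphEquations`, kernel M14b)

Decomp-mm node «GraphEquations» (lens 5); attacked leaf `MultiplicityReduction`, open core
`Purification`.  Target of the node, VERBATIM: `_root_.MatrixMultiplication`.  Companion of
`GraphEquationsOrderObstruction` (M14a).  For an arbitrary equation system `E`:
* `EqSystem.trim` — keep each in-range test index once: same circuit and zero set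
  (`trim_correct`), `|tests| ≤ cost` (`trim_tests_length_le`);
* `EqSystem.squareTests E k` — append `k` successive squaring gates per trimmed test and test the
  last powers: `cost ≤ (k+1)·cost` (`squareTests_cost_le`), correctness is preserved
  (`squareTests_correct`), the new tests are the `2^k`-th powers of the old ones
  (`squareTests_testPoly`) and lie in `I^(2^k)` when `E` is correct (`squareTests_testPoly_mem_pow`);
* `eqAdmissibleDeep_of_eqAdmissible : EqAdmissible β → EqAdmissibleDeep β (2^k)` (SAME exponent);
  `eqAdmissibleDeep_five_halves` unconditionally;
* `exists_family_without_inIdeal_purification` — **for every admissible `β` and every order `K`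
  there is a correct cost-`O(n^β)` family such that no system with tests in the IDEAL of its tests
  is `PureIsolatedAt K x` or `InitNondegAt K x` at any graph point**: «along a given cheap correct
  family the isolating ideal elements can be chosen with orders bounded uniformly in `n`»
  (NODE-g26 §3c `P_cost`) is refuted — purification must leave the test ideal (root extraction /
  saturation: `f^(2^k) ↦ f` costs `O(size)` independently of `k`).

No `sorry`.  Sources: [BurgisserClausenShokrollahi1997, Problem 16.3, (4.2)]; [Burgisser2000, 2.1].
-/
set_option linter.dupNamespace false

noncomputable section
open scoped BigOperators

namespace Summit.MatrixMultiplication.MatrixMultiplication.Theorems.GraphEquations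

open MvPolynomial Literature.Computability.AlgebraicComplexity
open Literature.Computability.AlgebraicComplexity.ArithCircuit

variable {n : ℕ}

namespace EqSystem

/-! ## Trimming: drop junk and duplicate test indices (`|tests| ≤ cost`) -/

/-- Keep each in-range test index once.  Same circuit, same zero set. -/
def trim (E : EqSystem n) : EqSystem n :=
  ⟨E.circuit, (E.tests.filter (· < E.cost)).dedup⟩

/-- Trimming keeps the circuit, hence the cost. -/
@[simp] theorem trim_cost (E : EqSystem n) : E.trim.cost = E.cost := rfl

/-- Trimming keeps the circuit. -/
@[simp] theorem trim_circuit (E : EqSystem n) : E.trim.circuit = E.circuit := rfl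

/-- Trimming keeps every test polynomial. -/
theorem trim_testPoly (E : EqSystem n) (j : ℕ) : E.trim.testPoly j = E.testPoly j := rfl

/-- The trimmed tests are the in-range old tests. -/
theorem mem_trim_tests {E : EqSystem n} {j : ℕ} : j ∈ E.trim.tests ↔ j ∈ E.tests ∧ j < E.cost := by
  simp [trim, List.mem_dedup, List.mem_filter]

/-- Trimmed test indices are in range. -/
theorem trim_tests_lt {E : EqSystem n} {j : ℕ} (hj : j ∈ E.trim.tests) : j < E.circuit.gates.length :=
  (mem_trim_tests.mp hj).2

/-- Out-of-range tests are the zero polynomial. -/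
theorem testPoly_eq_zero_of_le {E : EqSystem n} {j : ℕ} (hj : E.cost ≤ j) : E.testPoly j = 0 := by
  unfold testPoly
  rw [List.getD_eq_getElem?_getD, List.getElem?_eq_none (by simpa [cost, ArithCircuit.size] using hj)]
  rfl

/-- Trimming keeps the zero set (junk tests are the zero polynomial). -/
theorem trim_zeroSet (E : EqSystem n) : E.trim.zeroSet = E.zeroSet := by
  ext x
  simp only [zeroSet, Set.mem_setOf_eq, trim_testPoly, mem_trim_tests]
  constructor
  · intro h j hj
    by_cases hjc : j < E.cost
    · exact h j ⟨hj, hjc⟩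
    · rw [testPoly_eq_zero_of_le (not_lt.mp hjc), map_zero]
  · intro h j hj
    exact h j hj.1

/-- Trimming keeps correctness. -/
theorem trim_correct {E : EqSystem n} (hE : E.Correct) : E.trim.Correct :=
  ⟨hE.1, by rw [trim_zeroSet]; exact hE.2⟩

/-- After trimming, `|tests| ≤ cost`. -/
theorem trim_tests_length_le (E : EqSystem n) : E.trim.tests.length ≤ E.cost := by
  rw [show E.trim.tests.length = (E.tests.filter (· < E.cost)).toFinset.card by
    rw [List.card_toFinset]; rfl]
  calc (E.tests.filter (· < E.cost)).toFinset.card ≤ (Finset.range E.cost).card :=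
        Finset.card_le_card fun j hj => by
          rw [List.mem_toFinset, List.mem_filter] at hj
          simpa using hj.2
    _ = E.cost := Finset.card_range _

/-! ## Squaring the tests: correct systems with tests in `I^(2^k)` at linear cost -/

/-- The squaring gate `t_r ↦ t_r · t_r`. -/
def sqGate (r : ℕ) : Gate ℂ (GraphVars n) := Gate.prod [Operand.gate r, Operand.gate r]

/-- A squaring gate has fan-in two. -/
theorem sqGate_fanIn (r : ℕ) : (sqGate (n := n) r).fanIn = 2 := rfl

/-- A squaring gate squares. -/
theorem sqGate_eval (r : ℕ) (vals : List (MvPolynomial (GraphVars n) ℂ)) :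
    (sqGate (n := n) r).eval vals = vals.getD r 0 ^ 2 := by
  simp [sqGate, Gate.eval, Operand.eval, pow_two]

/-- Index of the current power of test `r` after `k` squarings appended to `L` gates. -/
def sqIdx (L r : ℕ) : ℕ → ℕ
  | 0 => r
  | k + 1 => L + k

/-- After `k+1` squarings the current power sits at gate `L + k`. -/
@[simp] theorem sqIdx_succ (L r k : ℕ) : sqIdx L r (k + 1) = L + k := rfl

/-- The current power is in range (given the test was). -/
theorem sqIdx_lt {L r : ℕ} (hr : r < L) (k : ℕ) : sqIdx L r k < L + k := by
  cases k with
  | zero => simpa [sqIdx] using hr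
  | succ k => simp [sqIdx]

/-- Append `k` successive squarings of gate `r`. -/
def sqIter (gs : List (Gate ℂ (GraphVars n))) (r : ℕ) : ℕ → List (Gate ℂ (GraphVars n))
  | 0 => gs
  | k + 1 => sqIter gs r k ++ [sqGate (sqIdx gs.length r k)]

/-- `k` squarings add `k` gates. -/
@[simp] theorem sqIter_length (gs : List (Gate ℂ (GraphVars n))) (r k : ℕ) :
    (sqIter gs r k).length = gs.length + k := by
  induction k with
  | zero => rfl
  | succ k ih => simp [sqIter, ih, Nat.add_assoc]

/-- Squarings are appended: the old gates are a prefix. -/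
theorem sqIter_prefix (gs : List (Gate ℂ (GraphVars n))) (r k : ℕ) :
    ∃ t, sqIter gs r k = gs ++ t := by
  induction k with
  | zero => exact ⟨[], by simp [sqIter]⟩
  | succ k ih =>
    obtain ⟨t, ht⟩ := ih
    exact ⟨t ++ [sqGate (sqIdx gs.length r k)], by simp [sqIter, ht]⟩

/-- Every gate after squarings is an old gate or a squaring gate. -/
theorem mem_sqIter {gs : List (Gate ℂ (GraphVars n))} {r k : ℕ} {g : Gate ℂ (GraphVars n)}
    (hg : g ∈ sqIter gs r k) : g ∈ gs ∨ ∃ r', g = sqGate r' := by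
  induction k with
  | zero => exact Or.inl hg
  | succ k ih =>
    simp only [sqIter, List.mem_append, List.mem_singleton] at hg
    rcases hg with hg | hg
    · exact ih hg
    · exact Or.inr ⟨_, hg⟩

/-- Value lists only grow under appending gates. -/
theorem gateValues_prefix (gs hs : List (Gate ℂ (GraphVars n))) :
    ∃ t, gateValues (gs ++ hs) = gateValues gs ++ t := by
  induction hs using List.reverseRecOn with
  | nil => exact ⟨[], by simp⟩
  | append_singleton hs g ih =>
    obtain ⟨t, ht⟩ := ih
    refine ⟨t ++ [g.eval (gateValues (gs ++ hs))], ?_⟩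
    rw [← List.append_assoc, gateValues_append_singleton, ht, List.append_assoc]

/-- Appending gates does not change the values of the old gates. -/
theorem getD_gateValues_append {gs hs : List (Gate ℂ (GraphVars n))} {i : ℕ} (hi : i < gs.length) :
    (gateValues (gs ++ hs)).getD i 0 = (gateValues gs).getD i 0 := by
  obtain ⟨t, ht⟩ := gateValues_prefix gs hs
  rw [ht, List.getD_eq_getElem?_getD, List.getD_eq_getElem?_getD,
    List.getElem?_append_left (by simpa using hi)]

/-- After `k` squarings the current gate holds `t_r^(2^k)`. -/
theorem getD_sqIter (gs : List (Gate ℂ (GraphVars n))) (r k : ℕ) :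
    (gateValues (sqIter gs r k)).getD (sqIdx gs.length r k) 0 = (gateValues gs).getD r 0 ^ 2 ^ k := by
  induction k with
  | zero => simp [sqIter, sqIdx]
  | succ k ih =>
    simp only [sqIter, sqIdx_succ, gateValues_append_singleton, sqGate_eval]
    rw [List.getD_eq_getElem?_getD, List.getElem?_append_right (by simp), ih]
    simp [pow_succ, pow_mul]

/-- Square every test of the list `k` times (tests processed left to right). -/
def sqAll (k : ℕ) : List (Gate ℂ (GraphVars n)) → List ℕ → List (Gate ℂ (GraphVars n)) × List ℕ
  | gs, [] => (gs, [])
  | gs, r :: rs => ((sqAll k (sqIter gs r k) rs).1, sqIdx gs.length r k :: (sqAll k (sqIter gs r k) rs).2)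

/-- Squaring all tests `k` times adds `k·|tests|` gates. -/
@[simp] theorem sqAll_length (k : ℕ) (gs : List (Gate ℂ (GraphVars n))) (rs : List ℕ) :
    (sqAll k gs rs).1.length = gs.length + k * rs.length := by
  induction rs generalizing gs with
  | nil => simp [sqAll]
  | cons r rs ih => simp [sqAll, ih]; ring

/-- One new test per old test. -/
@[simp] theorem sqAll_tests_length (k : ℕ) (gs : List (Gate ℂ (GraphVars n))) (rs : List ℕ) :
    (sqAll k gs rs).2.length = rs.length := by
  induction rs generalizing gs with
  | nil => simp [sqAll]
  | cons r rs ih => simp [sqAll, ih]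

/-- The old gates are a prefix after squaring all tests. -/
theorem sqAll_prefix (k : ℕ) (gs : List (Gate ℂ (GraphVars n))) (rs : List ℕ) :
    ∃ t, (sqAll k gs rs).1 = gs ++ t := by
  induction rs generalizing gs with
  | nil => exact ⟨[], by simp [sqAll]⟩
  | cons r rs ih =>
    obtain ⟨t₁, h₁⟩ := sqIter_prefix gs r k
    obtain ⟨t₂, h₂⟩ := ih (sqIter gs r k)
    refine ⟨t₁ ++ t₂, ?_⟩
    simp only [sqAll]
    rw [h₂, h₁, List.append_assoc]

/-- Every gate after squaring all tests is an old gate or a squaring gate. -/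
theorem mem_sqAll {k : ℕ} {gs : List (Gate ℂ (GraphVars n))} {rs : List ℕ} {g : Gate ℂ (GraphVars n)}
    (hg : g ∈ (sqAll k gs rs).1) : g ∈ gs ∨ ∃ r', g = sqGate r' := by
  induction rs generalizing gs with
  | nil => exact Or.inl (by simpa [sqAll] using hg)
  | cons r rs ih =>
    simp only [sqAll] at hg
    rcases ih hg with h | h
    · exact mem_sqIter h
    · exact Or.inr h

/-- The new test indices are in range. -/
theorem sqAll_tests_lt {k : ℕ} {gs : List (Gate ℂ (GraphVars n))} {rs : List ℕ}
    (hrs : ∀ r ∈ rs, r < gs.length) : ∀ j ∈ (sqAll k gs rs).2, j < (sqAll k gs rs).1.length := by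
  induction rs generalizing gs with
  | nil => simp [sqAll]
  | cons r rs ih =>
    intro j hj
    simp only [sqAll, List.mem_cons] at hj
    have hrs' : ∀ r' ∈ rs, r' < (sqIter gs r k).length := fun r' hr' => by
      simp only [sqIter_length]; exact Nat.lt_add_right k (hrs r' (List.mem_cons_of_mem _ hr'))
    rcases hj with rfl | hj
    · simp only [sqAll, sqAll_length, sqIter_length]
      have := sqIdx_lt (hrs r List.mem_cons_self) k
      exact lt_of_lt_of_le this (Nat.le_add_right _ _)
    · simp only [sqAll]
      exact ih hrs' j hj

/-- **The values of the new tests are the `2^k`-th powers of the old ones.** -/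
theorem getD_sqAll {k : ℕ} {gs : List (Gate ℂ (GraphVars n))} {rs : List ℕ}
    (hrs : ∀ r ∈ rs, r < gs.length) {o : ℕ} (ho : o < rs.length) :
    (gateValues (sqAll k gs rs).1).getD ((sqAll k gs rs).2.getD o 0) 0 =
      (gateValues gs).getD (rs.getD o 0) 0 ^ 2 ^ k := by
  induction rs generalizing gs o with
  | nil => simp at ho
  | cons r rs ih =>
    have hrs' : ∀ r' ∈ rs, r' < (sqIter gs r k).length := fun r' hr' => by
      simp only [sqIter_length]; exact Nat.lt_add_right k (hrs r' (List.mem_cons_of_mem _ hr'))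
    cases o with
    | zero =>
      simp only [sqAll, List.getD_cons_zero]
      obtain ⟨t, ht⟩ := sqAll_prefix k (sqIter gs r k) rs
      rw [ht, getD_gateValues_append (by simpa using sqIdx_lt (hrs r List.mem_cons_self) k),
        getD_sqIter]
    | succ o =>
      simp only [sqAll, List.getD_cons_succ]
      have ho' : o < rs.length := by simpa using ho
      have hmem : rs.getD o 0 ∈ rs := by
        rw [List.getD_eq_getElem?_getD, List.getElem?_eq_getElem ho', Option.getD_some]
        exact List.getElem_mem ho'
      rw [ih hrs' ho']
      obtain ⟨t, ht⟩ := sqIter_prefix gs r k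
      rw [ht, getD_gateValues_append (hrs _ (List.mem_cons_of_mem _ hmem))]

/-- `getD` in range is `getElem` (index bookkeeping). -/
theorem getD_eq_getElem_nat {l : List ℕ} {i : ℕ} (h : i < l.length) : l.getD i 0 = l[i] := by
  rw [List.getD_eq_getElem?_getD, List.getElem?_eq_getElem h, Option.getD_some]

/-- `getD` in range is a member (index bookkeeping). -/
theorem getD_mem_nat {l : List ℕ} {i : ℕ} (h : i < l.length) : l.getD i 0 ∈ l :=
  getD_eq_getElem_nat h ▸ List.getElem_mem h

/-- **Square every (trimmed) test `k` times.** -/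
def squareTests (E : EqSystem n) (k : ℕ) : EqSystem n where
  circuit := ⟨(sqAll k E.circuit.gates E.trim.tests).1, E.circuit.output⟩
  tests := (sqAll k E.circuit.gates E.trim.tests).2

/-- `cost(E^(k)) = cost(E) + k·|trimmed tests|`. -/
theorem squareTests_cost (E : EqSystem n) (k : ℕ) :
    (E.squareTests k).cost = E.cost + k * E.trim.tests.length := by
  simp [squareTests, cost, ArithCircuit.size]

/-- Linear cost: `cost(E^(k)) ≤ (k + 1) · cost(E)`. -/
theorem squareTests_cost_le (E : EqSystem n) (k : ℕ) : (E.squareTests k).cost ≤ (k + 1) * E.cost := by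
  rw [squareTests_cost]
  have := E.trim_tests_length_le
  nlinarith

/-- Squaring keeps fan-in two. -/
theorem squareTests_isFanInTwo {E : EqSystem n} (hE : E.circuit.IsFanInTwo) (k : ℕ) :
    (E.squareTests k).circuit.IsFanInTwo := by
  intro g hg
  rcases mem_sqAll hg with h | ⟨r', rfl⟩
  · exact hE g h
  · simp [sqGate_fanIn]

/-- `E^(k)` has one test per trimmed test of `E`. -/
@[simp] theorem squareTests_tests_length (E : EqSystem n) (k : ℕ) :
    (E.squareTests k).tests.length = E.trim.tests.length :=
  sqAll_tests_length _ _ _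

/-- **The new tests are the `2^k`-th powers of the (trimmed) old tests.** -/
theorem squareTests_testPoly (E : EqSystem n) (k : ℕ) {o : ℕ} (ho : o < E.trim.tests.length) :
    (E.squareTests k).testPoly ((E.squareTests k).tests.getD o 0) =
      E.testPoly (E.trim.tests.getD o 0) ^ 2 ^ k := by
  unfold testPoly
  exact getD_sqAll (fun r hr => trim_tests_lt hr) ho

/-- Squaring keeps the zero set: `t^(2^k) = 0 ↔ t = 0`. -/
theorem squareTests_zeroSet (E : EqSystem n) (k : ℕ) : (E.squareTests k).zeroSet = E.zeroSet := by
  rw [← E.trim_zeroSet]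
  ext x
  simp only [zeroSet, Set.mem_setOf_eq, trim_testPoly]
  constructor
  · intro h j hj
    obtain ⟨o, ho, hoj⟩ := List.mem_iff_getElem.mp hj
    have ho' : o < (E.squareTests k).tests.length := by simpa using ho
    have h1 := h _ (getD_mem_nat ho')
    rw [squareTests_testPoly E k ho, map_pow, getD_eq_getElem_nat ho, hoj] at h1
    exact pow_eq_zero_iff (pow_ne_zero k two_ne_zero) |>.mp h1
  · intro h j hj
    obtain ⟨o, ho', hoj⟩ := List.mem_iff_getElem.mp hj
    have ho : o < E.trim.tests.length := by simpa using ho'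
    rw [← hoj, ← getD_eq_getElem_nat ho', squareTests_testPoly E k ho, map_pow,
      h _ (getD_mem_nat ho), zero_pow (pow_ne_zero k two_ne_zero)]

/-- **Squaring preserves correctness.** -/
theorem squareTests_correct {E : EqSystem n} (hE : E.Correct) (k : ℕ) : (E.squareTests k).Correct :=
  ⟨squareTests_isFanInTwo hE.1 k, by rw [squareTests_zeroSet]; exact hE.2⟩

/-- **Every test of `E^(k)` lies in `I^(2^k)`** (`E` correct). -/
theorem squareTests_testPoly_mem_pow {E : EqSystem n} (hE : E.Correct) (k : ℕ)
    (o : Fin (E.squareTests k).tests.length) :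
    (E.squareTests k).testPoly ((E.squareTests k).tests.get o) ∈ graphIdeal n ^ 2 ^ k := by
  have ho : (o : ℕ) < E.trim.tests.length := by simpa using o.2
  rw [List.get_eq_getElem, ← getD_eq_getElem_nat o.2, squareTests_testPoly E k ho]
  refine Ideal.pow_mem_pow (mem_graphIdeal_of_vanishing fun y hy => ?_) _
  exact hE.eval_testPoly_eq_zero hy (mem_trim_tests.mp (getD_mem_nat ho)).1

end EqSystem

/-! ## Family level: the order obstruction along every admissible exponent -/

/-- `EqAdmissibleDeep β e`: correct systems of cost `O(n^β)` ALL of whose tests lie in `I^e`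
exist for all `n ≥ 1`. -/
def EqAdmissibleDeep (β : ℝ) (e : ℕ) : Prop :=
  ∃ c : ℝ, ∀ n : ℕ, 1 ≤ n → ∃ E : EqSystem n, E.Correct ∧
    (∀ o : Fin E.tests.length, E.testPoly (E.tests.get o) ∈ graphIdeal n ^ e) ∧
    (E.cost : ℝ) ≤ c * (n : ℝ) ^ β

/-- **Squaring along a family**: `EqAdmissible β → EqAdmissibleDeep β (2^k)` for every `k`
(same exponent, constant factor `k + 1`). -/
theorem eqAdmissibleDeep_of_eqAdmissible {β : ℝ} (h : EqAdmissible β) (k : ℕ) :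
    EqAdmissibleDeep β (2 ^ k) := by
  obtain ⟨c, hc⟩ := h
  refine ⟨(k + 1) * c, fun n hn => ?_⟩
  obtain ⟨E, hE, hcost⟩ := hc n hn
  refine ⟨E.squareTests k, EqSystem.squareTests_correct hE k,
    EqSystem.squareTests_testPoly_mem_pow hE k, ?_⟩
  have h1 : ((E.squareTests k).cost : ℝ) ≤ (k + 1) * (E.cost : ℝ) := by
    exact_mod_cast EqSystem.squareTests_cost_le E k
  calc ((E.squareTests k).cost : ℝ) ≤ (k + 1) * (E.cost : ℝ) := h1
    _ ≤ (k + 1) * (c * (n : ℝ) ^ β) := mul_le_mul_of_nonneg_left hcost (by positivity)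
    _ = (k + 1) * c * (n : ℝ) ^ β := by ring

/-- **ORDER OBSTRUCTION (family level; refutes «in-ideal purification with `K` uniform in `n`»).**
For every admissible exponent `β` and every order `K` there is a correct family of cost `O(n^β)`
(all `n ≥ 1`) such that NO system whose tests lie in the IDEAL of its tests — in particular no
recombination `Σ_o g_o t_o` computed at whatever cost — is pure-isolated or initial-form
nondegenerate to order `K` at ANY point of the graph. -/
theorem exists_family_without_inIdeal_purification {β : ℝ} (h : EqAdmissible β) (K : ℕ) :
    ∃ c : ℝ, ∀ n : ℕ, 1 ≤ n → ∃ E : EqSystem n, E.Correct ∧ (E.cost : ℝ) ≤ c * (n : ℝ) ^ β ∧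
      ∀ E' : EqSystem n,
        (∀ o : Fin E'.tests.length, E'.testPoly (E'.tests.get o) ∈
          Ideal.span (Set.range fun o : Fin E.tests.length => E.testPoly (E.tests.get o))) →
        ∀ x ∈ mmGraph n, ¬ E'.PureIsolatedAt K x ∧ ¬ E'.InitNondegAt K x := by
  have hK : K < 2 * 2 ^ K :=
    lt_of_lt_of_le Nat.lt_two_pow_self (Nat.le_mul_of_pos_left _ (by norm_num))
  obtain ⟨c, hc⟩ := eqAdmissibleDeep_of_eqAdmissible h K
  refine ⟨c, fun n hn => ?_⟩
  obtain ⟨E, hE, hdeep, hcost⟩ := hc n hn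
  exact ⟨E, hE, hcost, fun E' hE' x hx =>
    ⟨EqSystem.not_pureIsolatedAt_of_tests_mem_ideal hn hK hdeep hE' hx,
     EqSystem.not_initNondegAt_of_tests_mem_ideal hn hK hdeep hE' hx⟩⟩

/-- In particular (with M2: `ω < β ⇒ EqAdmissible β`, and `EqAdmissible (5/2)` unconditionally):
deep families exist at exponent `5/2` for every order. -/
theorem eqAdmissibleDeep_five_halves (e : ℕ) : EqAdmissibleDeep (5 / 2) e := by
  obtain ⟨c, hc⟩ := eqAdmissibleDeep_of_eqAdmissible eqAdmissible_five_halves e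
  refine ⟨c, fun n hn => ?_⟩
  obtain ⟨E, hE, hdeep, hcost⟩ := hc n hn
  refine ⟨E, hE, fun o => ?_, hcost⟩
  exact Ideal.pow_le_pow_right (Nat.lt_two_pow_self).le (hdeep o)

end Summit.MatrixMultiplication.MatrixMultiplication.Theorems.GraphEquations
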